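import Summits.CriticalPhenomena.Ising3DConformalLimit.Theses.SubPtolemyInterlacing
import Summits.CriticalPhenomena.Ising3DConformalLimit.Theorems.SubPtolemyInterlacingInterlacingAxisPair
import Literature.Probability.LatticeModels.PointwiseScalingLimitEtaExists
import HarnessLib

/-!
# Line `Sketch` for the crux `SubPtolemyInterlacing.Interlacing` (stmt-CriticalPhenomena-15702) — what the ALL-GAPS form costs:
# the `(1, b, 1)` corner of the crux is an energy–energy decay bound (`corner_energyExchange_le_curvature`)

THEOREM-ONLY helper file of the line `Sketch` (lead skeleton `Cruxes/Interlacing/Lines/Sketch.lean`), cycle 1 of the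
continuation lead. It isolates, as a Lean statement, the consequence of the crux in its tight corner `a = c = 1`:

`Interlacing ⇒ ∀ b ≥ 1, (S₄(0, e₁, (b+1)e₁, (b+2)e₁) − G(1)²) · G(b+1)² ≤ G(1)² · (G(b) G(b+2) − G(b+1)²)`,

i.e. (dividing by the positive `G(1)² G(b+1)²`) the truncated ENERGY–ENERGY correlation of the two unit bonds
`⟨σ₀σ_{e₁} ; σ_{(b+1)e₁}σ_{(b+2)e₁}⟩_{β_c} / ⟨σ₀σ_{e₁}⟩²` is at most the discrete LOG-CONVEXITY DEFECT
`t_b − 1 = G(b)G(b+2)/G(b+1)² − 1` of the axial two-point function (`corner_energyExchange_div_le`). For a two-point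
function regularly varying with index `−2Δ` the defect is `≍ 2Δ/b²`, while the energy–energy correlation is `≍ b^{-2Δ_ε}`;
so the all-gaps crux asserts, corner by corner, `b^{-2Δ_ε} ≲ b^{-2}` with explicit constants — the statement
"`Δ_ε(3) ≥ 1`" (mean-field / `d = 2` borderline `Δ_ε = 1`; conformal bootstrap `Δ_ε = 1.4126`), for which no rigorous
argument exists on `ℤ³`. The route's assembly never uses this corner (it consumes only the balanced dyadic shapes, see
`SubPtolemyInterlacingInterlacingBalancedSuffices.lean`), which is the lead's ground for recommending a `--restate` of the
crux to its eventual balanced form. No definitions, no named facts, no sorry.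
-/

noncomputable section

namespace Summit.CriticalPhenomena.Ising3DConformalLimit.Cruxes.Interlacing.Sketch

open Literature.Probability.LatticeModels
open Summit.CriticalPhenomena.Ising3DConformalLimit.Theses.SubPtolemyInterlacing (Interlacing)

/-- **Registered stub `corner_energyExchange_le_curvature` (corner consequence of the crux).** `Interlacing` at
`(a, b, c) = (1, b, 1)` reads, after the axis dictionary `stub_axisPair`,
`S₄ · G(b+1)² ≤ G(1)² · G(b+2) G(b)`, i.e. `(S₄ − G(1)²) · G(b+1)² ≤ G(1)² · (G(b) G(b+2) − G(b+1)²)`: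
the four-point EXCESS over the adjacent pairing (an energy–energy covariance) is dominated by the two-point
log-convexity defect. Pure rewriting + `linear_combination`. [folklore] -/
theorem corner_energyExchange_le_curvature : Interlacing → ∀ b : ℕ, 1 ≤ b →
    (criticalCorr 3 4 ![((0 : ℕ) : ℤ) • (Pi.single 0 1 : Site 3), ((1 : ℕ) : ℤ) • (Pi.single 0 1 : Site 3),
          ((1 + b : ℕ) : ℤ) • (Pi.single 0 1 : Site 3), ((1 + b + 1 : ℕ) : ℤ) • (Pi.single 0 1 : Site 3)] -
        criticalTwoPoint 3 (Pi.single 0 ((1 : ℕ) : ℤ)) ^ 2) *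
        criticalTwoPoint 3 (Pi.single 0 ((b + 1 : ℕ) : ℤ)) ^ 2 ≤
      criticalTwoPoint 3 (Pi.single 0 ((1 : ℕ) : ℤ)) ^ 2 *
        (criticalTwoPoint 3 (Pi.single 0 ((b : ℕ) : ℤ)) * criticalTwoPoint 3 (Pi.single 0 ((b + 2 : ℕ) : ℤ)) -
          criticalTwoPoint 3 (Pi.single 0 ((b + 1 : ℕ) : ℤ)) ^ 2) := by
  intro hI b hb
  have h := hI 1 b 1 le_rfl hb le_rfl
  -- the six pair correlators through the axis dictionary (in the crux's own `1 + b` spelling)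
  have h01 := stub_axisPair 0 1 (Nat.zero_le _)
  have h0b1 := stub_axisPair 0 (1 + b) (Nat.zero_le _)
  have h0b2 := stub_axisPair 0 (1 + b + 1) (Nat.zero_le _)
  have h1b2 := stub_axisPair 1 (1 + b + 1) (by omega)
  have hb1b2 := stub_axisPair (1 + b) (1 + b + 1) (by omega)
  have h1b1 := stub_axisPair 1 (1 + b) (by omega)
  rw [Nat.sub_zero] at h01 h0b1 h0b2
  rw [show 1 + b + 1 - 1 = b + 1 by omega] at h1b2
  rw [show 1 + b + 1 - (1 + b) = 1 by omega] at hb1b2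
  rw [show 1 + b - 1 = b by omega] at h1b1
  simp only [h01, h0b1, h0b2, h1b2, hb1b2, h1b1] at h
  -- align the index spellings `1 + b + 1 = b + 2`, `1 + b = b + 1` in `h` and in the goal
  rw [show (1 + b + 1 : ℕ) = b + 2 by omega, show (1 + b : ℕ) = b + 1 by omega] at h ⊢
  linear_combination h

/-- **Normalised corner form: energy exchange ≤ curvature.** For every `b ≥ 1`,
`(S₄(0,e₁,(b+1)e₁,(b+2)e₁) − G(1)²)/G(1)² ≤ G(b)G(b+2)/G(b+1)² − 1` under `Interlacing`
(divide `corner_energyExchange_le_curvature` by `G(1)² G(b+1)² > 0`, `criticalTwoPoint_axis_pos`). The left side is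
the truncated energy–energy correlation `⟨σ₀σ_{e₁};σ_{(b+1)e₁}σ_{(b+2)e₁}⟩/⟨σ₀σ_{e₁}⟩²` (`≍ b^{-2Δ_ε}`), the right side
the axial log-convexity defect `t_b − 1` (`≍ 2Δ/b²` for a regularly varying two-point function): the all-gaps crux
contains the decay statement `Δ_ε ≥ 1` with constants. [folklore] -/
theorem corner_energyExchange_div_le (hI : Interlacing) (b : ℕ) (hb : 1 ≤ b) :
    (criticalCorr 3 4 ![((0 : ℕ) : ℤ) • (Pi.single 0 1 : Site 3), ((1 : ℕ) : ℤ) • (Pi.single 0 1 : Site 3),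
          ((1 + b : ℕ) : ℤ) • (Pi.single 0 1 : Site 3), ((1 + b + 1 : ℕ) : ℤ) • (Pi.single 0 1 : Site 3)] -
        criticalTwoPoint 3 (Pi.single 0 ((1 : ℕ) : ℤ)) ^ 2) / criticalTwoPoint 3 (Pi.single 0 ((1 : ℕ) : ℤ)) ^ 2 ≤
      criticalTwoPoint 3 (Pi.single 0 ((b : ℕ) : ℤ)) * criticalTwoPoint 3 (Pi.single 0 ((b + 2 : ℕ) : ℤ)) /
          criticalTwoPoint 3 (Pi.single 0 ((b + 1 : ℕ) : ℤ)) ^ 2 - 1 := by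
  have h := corner_energyExchange_le_curvature hI b hb
  have h1 : 0 < criticalTwoPoint 3 (Pi.single 0 ((1 : ℕ) : ℤ)) := criticalTwoPoint_axis_pos 1
  have hb1 : 0 < criticalTwoPoint 3 (Pi.single 0 ((b + 1 : ℕ) : ℤ)) := criticalTwoPoint_axis_pos (b + 1)
  have h1sq : 0 < criticalTwoPoint 3 (Pi.single 0 ((1 : ℕ) : ℤ)) ^ 2 := by positivity
  have hb1sq : 0 < criticalTwoPoint 3 (Pi.single 0 ((b + 1 : ℕ) : ℤ)) ^ 2 := by positivity
  rw [div_le_iff₀ h1sq, sub_mul, div_mul_eq_mul_div, one_mul, le_sub_iff_add_le, le_div_iff₀ hb1sq]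
  nlinarith [h]

end Summit.CriticalPhenomena.Ising3DConformalLimit.Cruxes.Interlacing.Sketch

end
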